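import Mathlib
import Summits.Ventures.PercRepro2.UnionRowMech

/-!
# The bilinear reduction: from up-set indicators to all monotone observables
(blind cell PercRepro2, mine-1 g39; proofs/MINE1-UNIONROW2.md §1 (R2))

For a nonnegative `M` on the status grid and a set of cells `U`, the `Z²`-scaled row
`rowVal M U F G = Σ_{k ∈ U} M(k)·(Z·F(k) − Σ M F)·(Z·G(k) − Σ M G)` is bilinear in `(F, G)` and
vanishes when `F` is constant. A monotone `F` on the finite grid is a constant plus a
nonnegative combination of up-set indicators — peel off the lowest jump: with `m = min F` and
`r` the smallest value above `m`, `F = F′ + (r − m)·1_{F ≥ r}` with `F′` monotone taking one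
value fewer (`peel`). Hence:

**THEOREM** (`rowVal_nonneg_of_upsets`): if `rowVal M U 1_A 1_B ≥ 0` for all up-sets `A, B`,
then `rowVal M U F G ≥ 0` for all monotone `F, G`.
-/

namespace Summit.Ventures.PercRepro2

namespace UnionRowMech

open Finset

/-- The centred vector `Z·F(k) − Σ_j M(j) F(j)`. -/
noncomputable def centred (M : Grid → ℝ) (F : Grid → ℝ) (k : Grid) : ℝ :=
  total M * F k - ∑ j, M j * F j

/-- The `Z²`-scaled row over the cells `U`. -/
noncomputable def rowVal (M : Grid → ℝ) (U : Finset Grid) (F G : Grid → ℝ) : ℝ :=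
  ∑ k ∈ U, M k * centred M F k * centred M G k

/-- The indicator of a set of cells. -/
noncomputable def ind (A : Finset Grid) : Grid → ℝ := fun k => if k ∈ A then 1 else 0

/-- The centred vector is additive. -/
lemma centred_add (M F F' : Grid → ℝ) (k : Grid) :
    centred M (fun j => F j + F' j) k = centred M F k + centred M F' k := by
  unfold centred
  simp only [mul_add, Finset.sum_add_distrib]
  ring

/-- The centred vector is homogeneous. -/
lemma centred_smul (M F : Grid → ℝ) (a : ℝ) (k : Grid) :
    centred M (fun j => a * F j) k = a * centred M F k := by
  unfold centred
  have : ∑ j, M j * (a * F j) = a * ∑ j, M j * F j := by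
    rw [Finset.mul_sum]
    refine Finset.sum_congr rfl fun j _ => ?_
    ring
  rw [this]
  ring

/-- The centred vector of a constant vanishes. -/
lemma centred_const (M : Grid → ℝ) (c : ℝ) (k : Grid) : centred M (fun _ => c) k = 0 := by
  unfold centred total
  rw [← Finset.sum_mul]
  ring

/-- `rowVal` is additive in the first slot. -/
lemma rowVal_add_left (M : Grid → ℝ) (U : Finset Grid) (F F' G : Grid → ℝ) :
    rowVal M U (fun j => F j + F' j) G = rowVal M U F G + rowVal M U F' G := by
  unfold rowVal
  rw [← Finset.sum_add_distrib]
  refine Finset.sum_congr rfl fun k _ => ?_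
  rw [centred_add]
  ring

/-- `rowVal` is homogeneous in the first slot. -/
lemma rowVal_smul_left (M : Grid → ℝ) (U : Finset Grid) (F G : Grid → ℝ) (a : ℝ) :
    rowVal M U (fun j => a * F j) G = a * rowVal M U F G := by
  unfold rowVal
  rw [Finset.mul_sum]
  refine Finset.sum_congr rfl fun k _ => ?_
  rw [centred_smul]
  ring

/-- `rowVal` vanishes on constants in the first slot. -/
lemma rowVal_const_left (M : Grid → ℝ) (U : Finset Grid) (c : ℝ) (G : Grid → ℝ) :
    rowVal M U (fun _ => c) G = 0 := by
  unfold rowVal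
  refine Finset.sum_eq_zero fun k _ => ?_
  rw [centred_const]
  ring

/-- `rowVal` is symmetric. -/
lemma rowVal_comm (M : Grid → ℝ) (U : Finset Grid) (F G : Grid → ℝ) :
    rowVal M U F G = rowVal M U G F := by
  unfold rowVal
  refine Finset.sum_congr rfl fun k _ => ?_
  ring

/-! ### Peeling the lowest jump of a monotone function -/

/-- The number of distinct values of `F`. -/
noncomputable def nvals (F : Grid → ℝ) : ℕ := (Finset.univ.image F).card

/-- `F` has at least one value. -/
lemma one_le_nvals (F : Grid → ℝ) : 1 ≤ nvals F :=
  Finset.card_pos.2 ⟨F (0, 0), Finset.mem_image_of_mem F (Finset.mem_univ _)⟩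

/-- A function with at most one value is constant. -/
lemma eq_const_of_nvals_le_one {F : Grid → ℝ} (h : nvals F ≤ 1) : ∀ k, F k = F (0, 0) := by
  intro k
  have hk : F k ∈ Finset.univ.image F := Finset.mem_image_of_mem F (Finset.mem_univ k)
  have h0 : F (0, 0) ∈ Finset.univ.image F := Finset.mem_image_of_mem F (Finset.mem_univ _)
  exact Finset.card_le_one.1 h _ hk _ h0

/-- **The peel**: for a monotone `F` with at least two values, with `m = min F` and `r` the
smallest value above `m`: `F = F′ + (r − m)·1_A` where `A = {F ≥ r}` is an up-set, `F′` is
monotone, `r − m > 0`, and `F′` has fewer values. -/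
lemma peel {F : Grid → ℝ} (hF : Monotone F) (h2 : 2 ≤ nvals F) :
    ∃ (F' : Grid → ℝ) (A : Finset Grid) (a : ℝ), Monotone F' ∧ IsUp A ∧ 0 < a ∧
      nvals F' < nvals F ∧ ∀ k, F k = F' k + a * ind A k := by
  classical
  set S := Finset.univ.image F with hS
  have hSne : S.Nonempty := ⟨F (0, 0), Finset.mem_image_of_mem F (Finset.mem_univ _)⟩
  set m := S.min' hSne with hm
  have hmS : m ∈ S := Finset.min'_mem S hSne
  have hm_le : ∀ x ∈ S, m ≤ x := fun x hx => Finset.min'_le S x hx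
  set S' := S.filter (fun x => m < x) with hS'
  have hS'ne : S'.Nonempty := by
    by_contra hemp
    rw [Finset.not_nonempty_iff_eq_empty] at hemp
    have hall : ∀ x ∈ S, x = m := by
      intro x hx
      by_contra hne
      have hlt : m < x := lt_of_le_of_ne (hm_le x hx) (Ne.symm hne)
      have hx' : x ∈ S' := Finset.mem_filter.2 ⟨hx, hlt⟩
      rw [hemp] at hx'
      exact Finset.notMem_empty x hx'
    have hcard : S.card ≤ 1 :=
      Finset.card_le_one.2 fun x hx y hy => by rw [hall x hx, hall y hy]
    have h2' : 2 ≤ S.card := h2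
    omega
  set r := S'.min' hS'ne with hr
  have hrS' : r ∈ S' := Finset.min'_mem S' hS'ne
  have hmr : m < r := (Finset.mem_filter.1 hrS').2
  have hrS : r ∈ S := (Finset.mem_filter.1 hrS').1
  have hr_le : ∀ x ∈ S, m < x → r ≤ x := fun x hx hlt =>
    Finset.min'_le S' x (Finset.mem_filter.2 ⟨hx, hlt⟩)
  have hdich : ∀ k, F k = m ∨ r ≤ F k := by
    intro k
    have hk : F k ∈ S := Finset.mem_image_of_mem F (Finset.mem_univ k)
    rcases eq_or_lt_of_le (hm_le _ hk) with h | h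
    · exact Or.inl h.symm
    · exact Or.inr (hr_le _ hk h)
  set A := Finset.univ.filter (fun k => r ≤ F k) with hA
  have hAup : IsUp A := by
    intro k k' hle hk
    simp only [hA, Finset.mem_filter, Finset.mem_univ, true_and] at hk ⊢
    exact le_trans hk (hF hle)
  have hmemA : ∀ k, k ∈ A ↔ r ≤ F k := by
    intro k
    simp only [hA, Finset.mem_filter, Finset.mem_univ, true_and]
  set F' : Grid → ℝ := fun k => F k - (r - m) * ind A k with hF'
  refine ⟨F', A, r - m, ?_, hAup, by linarith, ?_, fun k => by simp only [hF']; ring⟩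
  · -- `F′` is monotone
    intro k k' hle
    simp only [hF', ind]
    by_cases hk : k ∈ A
    · have hk' : k' ∈ A := hAup hle hk
      rw [if_pos hk, if_pos hk']
      linarith [hF hle]
    · rw [if_neg hk, mul_zero, sub_zero]
      have hkm : F k = m := by
        rcases hdich k with h | h
        · exact h
        · exact absurd ((hmemA k).2 h) hk
      by_cases hk' : k' ∈ A
      · rw [if_pos hk']
        have : r ≤ F k' := (hmemA k').1 hk'
        linarith
      · rw [if_neg hk', mul_zero, sub_zero]
        exact hF hle
  · -- `F′` has fewer values: its image lies in the image of `S ∖ {r}` under the shift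
    set φ : ℝ → ℝ := fun x => if r ≤ x then x - (r - m) else x with hφ
    have hsub : Finset.univ.image F' ⊆ (S.erase r).image φ := by
      intro y hy
      obtain ⟨k, -, rfl⟩ := Finset.mem_image.1 hy
      have hk : F k ∈ S := Finset.mem_image_of_mem F (Finset.mem_univ k)
      have hmer : m ∈ S.erase r := Finset.mem_erase.2 ⟨ne_of_lt hmr, hmS⟩
      refine Finset.mem_image.2 ?_
      by_cases hkA : k ∈ A
      · have hrk : r ≤ F k := (hmemA k).1 hkA
        by_cases hkr : F k = r
        · refine ⟨m, hmer, ?_⟩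
          simp only [hφ, hF', ind, if_pos hkA, hkr, if_neg (not_le.2 hmr)]
          ring
        · refine ⟨F k, Finset.mem_erase.2 ⟨hkr, hk⟩, ?_⟩
          simp only [hφ, hF', ind, if_pos hkA, if_pos hrk]
          ring
      · have hkm : F k = m := by
          rcases hdich k with h | h
          · exact h
          · exact absurd ((hmemA k).2 h) hkA
        refine ⟨m, hmer, ?_⟩
        simp only [hφ, hF', ind, if_neg hkA, if_neg (not_le.2 hmr), hkm]
        ring
    unfold nvals
    calc (Finset.univ.image F').card ≤ ((S.erase r).image φ).card := Finset.card_le_card hsub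
      _ ≤ (S.erase r).card := Finset.card_image_le
      _ = S.card - 1 := Finset.card_erase_of_mem hrS
      _ < S.card := by
          have := Finset.card_pos.2 hSne
          omega

/-! ### The reduction -/

/-- **The bilinear reduction**: if the `Z²`-scaled row is nonnegative on all pairs of up-set
indicators, it is nonnegative on all pairs of monotone functions. -/
theorem rowVal_nonneg_of_upsets (M : Grid → ℝ) (U : Finset Grid)
    (h : ∀ A B : Finset Grid, IsUp A → IsUp B → 0 ≤ rowVal M U (ind A) (ind B)) :
    ∀ F G : Grid → ℝ, Monotone F → Monotone G → 0 ≤ rowVal M U F G := by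
  -- stage 1: an up-set indicator against a monotone function, by induction on the values
  have stage1 : ∀ n : ℕ, ∀ G : Grid → ℝ, Monotone G → nvals G ≤ n →
      ∀ A : Finset Grid, IsUp A → 0 ≤ rowVal M U (ind A) G := by
    intro n
    induction n with
    | zero =>
      intro G _ hn
      have := one_le_nvals G
      omega
    | succ n ih =>
      intro G hG hn A hA
      by_cases h1 : nvals G ≤ 1
      · have hc : G = fun _ => G (0, 0) := funext (eq_const_of_nvals_le_one h1)
        rw [hc, rowVal_comm, rowVal_const_left]
      · obtain ⟨G', B, a, hG', hB, ha, hlt, heq⟩ := peel hG (by omega)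
        have hGeq : G = fun k => G' k + a * ind B k := funext heq
        rw [hGeq, rowVal_comm, rowVal_add_left, rowVal_smul_left, rowVal_comm M U G',
          rowVal_comm M U (ind B)]
        have i1 := ih G' hG' (by omega) A hA
        have i2 := h A B hA hB
        exact add_nonneg i1 (mul_nonneg ha.le i2)
  -- stage 2: two monotone functions, by induction on the values of the first
  have stage2 : ∀ n : ℕ, ∀ F : Grid → ℝ, Monotone F → nvals F ≤ n →
      ∀ G : Grid → ℝ, Monotone G → 0 ≤ rowVal M U F G := by
    intro n
    induction n with
    | zero =>
      intro F _ hn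
      have := one_le_nvals F
      omega
    | succ n ih =>
      intro F hF hn G hG
      by_cases h1 : nvals F ≤ 1
      · have hc : F = fun _ => F (0, 0) := funext (eq_const_of_nvals_le_one h1)
        rw [hc, rowVal_const_left]
      · obtain ⟨F', A, a, hF', hA, ha, hlt, heq⟩ := peel hF (by omega)
        have hFeq : F = fun k => F' k + a * ind A k := funext heq
        rw [hFeq, rowVal_add_left, rowVal_smul_left]
        have i1 := ih F' hF' (by omega) G hG
        have i2 := stage1 _ G hG le_rfl A hA
        exact add_nonneg i1 (mul_nonneg ha.le i2)
  intro F G hF hG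
  exact stage2 _ F hF le_rfl G hG

end UnionRowMech

end Summit.Ventures.PercRepro2
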